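import Summits.BirchSwinnertonDyer.BirchSwinnertonDyer.Theorems.UniversalToricDescentRoadFFPerLevelDescent
import Summits.BirchSwinnertonDyer.BirchSwinnertonDyer.Theorems.UniversalToricDescentRoadFFDescentOddRational
import HarnessLib

/-!
# Route `UniversalToricDescent`, ♭B column (♭B′ `TwinWanFrameAtThreeMultTresT` 27401), line `membertower`:
# `p`-SATURATION of a member `L`-function under a UNIT congruence — the algebra that turns the growth clause of the
# per-level member tower into a theorem

Cell `bsd-wall` (run/shared/lean/pub/bsd-wall/), seat `bsd-wall-utd-p2` (lead prover g13, 2026-08-28);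
`--supports stmt-BirchSwinnertonDyer-27401 --as helper`; Theses-free. Consumer: `…RoadFFMemberSaturationTwin.lean`.

§1 Over any commutative ring `S` with `π` a non-zero-divisor: a power series of the shape `Y = X^s·U + C π·G` with `U`
a unit is `π`-SATURATED — `Y ∣ C π·F → Y ∣ F` (`dvd_of_dvd_C_mul_of_shape`; in `(S/π)⟦X⟧` the image of `Y` is `X^s`
times a unit); consequently a one-sided inclusion `(C π^e)·I ⊆ (L_m)` with ANY exponent `e`, for
`L_m = u·(C π^t·M′) + C π^m·G₀` with `u` a unit, `M′` of that shape and `t < m`, improves to `(C π^t)·I ⊆ (L_m)`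
(`span_pow_mul_le_of_unitCong`). §2 In `R₀⟦T⟧` (`R₀ = unrIntegers p`, a DVR with uniformiser `p`): a series with
a unit coefficient has the shape `X^s·V + C p·Q`, `V` a unit (`exists_shape_of_isUnit_coeff`); `p ∤ Z` iff `Z` has
a unit coefficient; the finite-`μ` split `Z = C p^t·Z′`. §3 The universal receptacle `R₀ ⊗_{ℤ_p} 𝒪` is
`p`-torsion-free for `𝒪` free over `ℤ_p`, every receptacle `(S₀, a, b)` receives it (`Algebra.TensorProduct.lift`),
and the per-level receptacle clause of the member tower (exponent `t`, one-sided congruence) follows in EVERY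
receptacle from a unit congruence with ANY exponent in the `p`-torsion-free ones (`receptacle_clause_of_unitCong`).
HONEST FRAMING: theorems only (pure algebra); nothing booked; BSD is proved for no curve.
References: [Washington1997] §7.1; [Skinner2016PacificMC] §3.1 (the member mechanism); [Castella2018Erratum] (2.5).
-/

set_option autoImplicit false

noncomputable section

open scoped TensorProduct Classical

open PowerSeries Literature.NumberTheory.EllipticCurves Summit.BirchSwinnertonDyer.Rank1Residual.X2
  Summit.BirchSwinnertonDyer.Rank1Residual.X11b.Halves

namespace Summit.BirchSwinnertonDyer.Rank1Residual.X11b.RoadFFSaturation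

/-! ### §1 `p`-saturation of `X^s·U + C p·G` over a `p`-torsion-free coefficient ring -/

section Generic

variable {S : Type*} [CommRing S]

/-- Every coefficient of `C π·W` is a multiple of `π`. [folklore] -/
theorem dvd_coeff_C_mul (π : S) (W : PowerSeries S) (n : ℕ) : π ∣ coeff n (C π * W) := by
  rw [coeff_C_mul]
  exact dvd_mul_right π _

/-- A power series all of whose coefficients are multiples of `π` is `C π` times a power series. [folklore] -/
theorem exists_eq_C_mul_of_dvd_coeff (π : S) {H : PowerSeries S} (h : ∀ n : ℕ, π ∣ coeff n H) :
    ∃ H₁ : PowerSeries S, H = C π * H₁ := by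
  choose g hg using h
  refine ⟨PowerSeries.mk g, PowerSeries.ext fun n ↦ ?_⟩
  rw [coeff_C_mul, coeff_mk]
  exact hg n

/-- If every coefficient of `A` is a multiple of `π`, so is every coefficient of `B·A`. [folklore] -/
theorem dvd_coeff_mul_of_dvd_coeff (π : S) {A : PowerSeries S} (B : PowerSeries S)
    (h : ∀ n : ℕ, π ∣ coeff n A) (n : ℕ) : π ∣ coeff n (B * A) := by
  rw [coeff_mul]
  exact Finset.dvd_sum fun ij _ ↦ dvd_mul_of_dvd_right (h ij.2) _

/-- If every coefficient of `X^s·A` is a multiple of `π`, so is every coefficient of `A` (shift). [folklore] -/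
theorem dvd_coeff_of_dvd_coeff_X_pow_mul (π : S) {A : PowerSeries S} (s : ℕ)
    (h : ∀ n : ℕ, π ∣ coeff n (X ^ s * A)) (n : ℕ) : π ∣ coeff n A := by
  have := h (n + s)
  rwa [coeff_X_pow_mul] at this

/-- `C π` is a non-zero-divisor on `S⟦X⟧` when `π` is one on `S` (coefficientwise). [folklore] -/
theorem eq_zero_of_C_mul_eq_zero {π : S} (hπ : ∀ x : S, π * x = 0 → x = 0) {A : PowerSeries S}
    (h : C π * A = 0) : A = 0 := by
  ext n
  have := congrArg (coeff n) h
  rw [coeff_C_mul, map_zero] at this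
  rw [map_zero]
  exact hπ _ this

/-- **`p`-SATURATION.** Over a commutative ring `S` in which `π` is a non-zero-divisor, a power series of the shape
`Y = X^s·U + C π·G` with `U` a unit is `π`-saturated: `Y ∣ C π·F → Y ∣ F`. Proof: `C π·F = Y·H` gives
`X^s·(U·H) = C π·(F − G·H)`, so every coefficient of `U·H`, hence of `H`, is a multiple of `π`; write `H = C π·H₁`
and cancel `C π`. (In `(S/π)⟦X⟧` the image of `Y` is `X^s` times a unit, and `X` is a non-zero-divisor.) [folklore] -/
theorem dvd_of_dvd_C_mul_of_shape {π : S} (hπ : ∀ x : S, π * x = 0 → x = 0) {Y U G : PowerSeries S}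
    (hU : IsUnit U) (s : ℕ) (hY : Y = X ^ s * U + C π * G) {F : PowerSeries S} (h : Y ∣ C π * F) : Y ∣ F := by
  obtain ⟨H, hH⟩ := h
  -- `X^s·(U·H) = C π·(F − G·H)`
  have hkey : X ^ s * (U * H) = C π * (F - G * H) := by
    have := hH
    rw [hY] at this
    linear_combination (-1 : PowerSeries S) * this
  have hUH : ∀ n : ℕ, π ∣ coeff n (U * H) :=
    dvd_coeff_of_dvd_coeff_X_pow_mul π s (fun n ↦ by rw [hkey]; exact dvd_coeff_C_mul π _ n)
  have hH' : ∀ n : ℕ, π ∣ coeff n H := by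
    intro n
    obtain ⟨u, rfl⟩ := hU
    have := dvd_coeff_mul_of_dvd_coeff π (↑u⁻¹ : PowerSeries S) hUH n
    rwa [← mul_assoc, Units.inv_mul, one_mul] at this
  obtain ⟨H₁, rfl⟩ := exists_eq_C_mul_of_dvd_coeff π hH'
  refine ⟨H₁, ?_⟩
  have h0 : C π * (F - Y * H₁) = 0 := by
    rw [mul_sub, hH]; ring
  exact sub_eq_zero.mp (eq_zero_of_C_mul_eq_zero hπ h0)

/-- Iterated `p`-saturation: `Y ∣ C π^k·F → Y ∣ F`. [folklore] -/
theorem dvd_of_dvd_C_pow_mul_of_shape {π : S} (hπ : ∀ x : S, π * x = 0 → x = 0) {Y U G : PowerSeries S}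
    (hU : IsUnit U) (s : ℕ) (hY : Y = X ^ s * U + C π * G) (k : ℕ) {F : PowerSeries S}
    (h : Y ∣ C π ^ k * F) : Y ∣ F := by
  induction k generalizing F with
  | zero => simpa using h
  | succ k ih =>
    exact ih (dvd_of_dvd_C_mul_of_shape hπ hU s hY (by rwa [pow_succ', mul_assoc] at h))

/-- **The exponent improvement.** In `S⟦X⟧` with `π` a non-zero-divisor on `S`: if `L_m = u·(C π^t·M′) + C π^m·G₀`
with `u` a unit, `M′ = X^s·V + C π·Q` with `V` a unit, and `t < m`, then a one-sided inclusion `(C π^e)·I ⊆ (L_m)`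
with ANY exponent `e` improves to `(C π^t)·I ⊆ (L_m)`: for `e ≤ t` trivially, for `e > t` by `p`-saturation of
`L_m / C π^t = X^s·(u·V) + C π·(u·Q + C π^{m−t−1}·G₀)`. [folklore] -/
theorem span_pow_mul_le_of_unitCong {π : S} (hπ : ∀ x : S, π * x = 0 → x = 0)
    {Lm u M' V Q G₀ : PowerSeries S} (hu : IsUnit u) (hV : IsUnit V) (s t m e : ℕ) (htm : t < m)
    (hM' : M' = X ^ s * V + C π * Q) (hLm : Lm = u * (C π ^ t * M') + C π ^ m * G₀)
    (I : Ideal (PowerSeries S)) (hI : Ideal.span {C π ^ e} * I ≤ Ideal.span {Lm}) :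
    Ideal.span {C π ^ t} * I ≤ Ideal.span {Lm} := by
  -- the saturated quotient `Y = L_m / C π^t`
  obtain ⟨d, rfl⟩ : ∃ d : ℕ, m = t + 1 + d := ⟨m - t - 1, by omega⟩
  set Y : PowerSeries S := X ^ s * (u * V) + C π * (u * Q + C π ^ d * G₀) with hYdef
  have hLmY : Lm = C π ^ t * Y := by
    rw [hLm, hM', hYdef, pow_add, pow_add, pow_one]
    ring
  have hUV : IsUnit (u * V) := hu.mul hV
  have hπCk : ∀ (k : ℕ) (A : PowerSeries S), C π ^ k * A = 0 → A = 0 := by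
    intro k
    induction k with
    | zero => intro A hA; simpa using hA
    | succ k ih =>
      intro A hA
      refine ih A (eq_zero_of_C_mul_eq_zero hπ ?_)
      rw [← mul_assoc, ← pow_succ']
      exact hA
  rw [Ideal.span_singleton_mul_le_iff] at hI ⊢
  intro z hz
  rcases Nat.lt_or_ge t e with hte | het
  · -- `e > t`: saturate
    obtain ⟨H, hH⟩ := Ideal.mem_span_singleton'.mp (hI z hz)
    -- `hH : H * Lm = C π^e * z`, i.e. `C π^t·(Y·H) = C π^t·(C π^{e-t}·z)`
    have hYdvd : Y ∣ C π ^ (e - t) * z := by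
      refine ⟨H, sub_eq_zero.mp (hπCk t _ ?_)⟩
      rw [mul_sub, ← mul_assoc, ← pow_add, show t + (e - t) = e by omega, ← hH, hLmY]
      ring
    obtain ⟨H₁, hH₁⟩ := dvd_of_dvd_C_pow_mul_of_shape hπ hUV s hYdef (e - t) hYdvd
    rw [hH₁, hLmY]
    exact Ideal.mem_span_singleton'.mpr ⟨H₁, by ring⟩
  · -- `e ≤ t`: `C π^t·z = C π^{t-e}·(C π^e·z)`
    have := Ideal.mul_mem_left _ (C π ^ (t - e)) (hI z hz)
    rwa [← mul_assoc, ← pow_add, show t - e + e = t by omega] at this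

end Generic

/-! ### §2 Shapes in `R₀⟦T⟧` (`R₀ = unrIntegers p`, a DVR with uniformiser `p`) -/

section UnrShape

variable {p : ℕ} [Fact p.Prime]

/-- In `R₀` a non-unit is a multiple of `p` (the maximal ideal of the DVR `R₀` is `(p)`).
[cite: SerreLocalFields1979, Ch. II §5, Thm. 3] -/
theorem natCast_p_dvd_of_not_isUnit {x : unrIntegers p} (hx : ¬ IsUnit x) : ((p : ℕ) : unrIntegers p) ∣ x := by
  haveI := HidaLimitAlgebra.isDiscreteValuationRing_unrIntegers (p := p)
  have hmem : x ∈ IsLocalRing.maximalIdeal (unrIntegers p) := hx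
  rw [HidaLimitAlgebra.irreducible_natCast_p.maximalIdeal_eq] at hmem
  exact Ideal.mem_span_singleton.mp hmem

/-- **The shape of a `μ = 0` series in `R₀⟦T⟧`**: a series with a unit coefficient is `X^s·V + C p·Q` with `V` a
unit (`s` = the first unit coefficient; the earlier coefficients are non-units, hence multiples of `p`).
[cite: Washington1997, §7.1 (proof of the division lemma)] -/
theorem exists_shape_of_isUnit_coeff {Z : UnrSeries p} (hZ : ∃ i : ℕ, IsUnit (coeff i Z)) :
    ∃ (s : ℕ) (V Q : UnrSeries p), IsUnit V ∧ Z = X ^ s * V + C ((p : ℕ) : unrIntegers p) * Q := by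
  classical
  have hs : IsUnit (coeff (Nat.find hZ) Z) := Nat.find_spec hZ
  have hlt : ∀ i : ℕ, i < Nat.find hZ → ¬ IsUnit (coeff i Z) := fun i hi ↦ Nat.find_min hZ hi
  set s : ℕ := Nat.find hZ with hsdef
  choose q hq using fun i : {i : ℕ // i < s} ↦ natCast_p_dvd_of_not_isUnit (hlt i.1 i.2)
  refine ⟨s, PowerSeries.mk fun i ↦ coeff (i + s) Z,
    PowerSeries.mk fun i ↦ if h : i < s then q ⟨i, h⟩ else 0, ?_, ?_⟩
  · rw [PowerSeries.isUnit_iff_constantCoeff, constantCoeff_mk, zero_add]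
    exact hs
  · refine PowerSeries.ext fun n ↦ ?_
    rw [map_add, coeff_X_pow_mul', coeff_C_mul]
    by_cases h₁ : s ≤ n
    · rw [if_pos h₁, coeff_mk, coeff_mk, dif_neg (not_lt.mpr h₁), Nat.sub_add_cancel h₁, mul_zero, add_zero]
    · rw [if_neg h₁, coeff_mk, dif_pos (not_le.mp h₁), zero_add]
      exact hq ⟨n, not_le.mp h₁⟩

/-- In `R₀⟦T⟧`: `p ∤ Z` ⟹ `Z` has a unit coefficient (else every coefficient is a multiple of `p`).
[cite: Washington1997, §7.1] -/
theorem exists_isUnit_coeff_of_not_C_dvd {Z : UnrSeries p}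
    (h : ¬ (C ((p : ℕ) : unrIntegers p) : UnrSeries p) ∣ Z) : ∃ i : ℕ, IsUnit (coeff i Z) := by
  by_contra hne
  obtain ⟨H₁, hH₁⟩ := exists_eq_C_mul_of_dvd_coeff ((p : ℕ) : unrIntegers p)
    (fun n ↦ natCast_p_dvd_of_not_isUnit fun hn ↦ hne ⟨n, hn⟩)
  exact h ⟨H₁, hH₁⟩

/-- In `R₀⟦T⟧`: a unit coefficient ⟹ `p ∤ Z`. [cite: Washington1997, §7.1] -/
theorem not_C_dvd_of_exists_isUnit_coeff {Z : UnrSeries p} (hZ : ∃ i : ℕ, IsUnit (coeff i Z)) :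
    ¬ (C ((p : ℕ) : unrIntegers p) : UnrSeries p) ∣ Z := by
  rintro ⟨M, hM⟩
  obtain ⟨i, hi⟩ := hZ
  rw [hM, coeff_C_mul] at hi
  exact CongruenceDescent.prime_natCast_p_unrIntegers.not_unit (isUnit_of_mul_isUnit_left hi)

/-- In `R₀⟦T⟧`: the product of two series with unit coefficients has a unit coefficient (`C p` is prime:
`R₀⟦T⟧/(p) ≅ 𝔽̄_p⟦T⟧` is a domain). [cite: Washington1997, §7.1] -/
theorem exists_isUnit_coeff_mul {A B : UnrSeries p} (hA : ∃ i : ℕ, IsUnit (coeff i A))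
    (hB : ∃ i : ℕ, IsUnit (coeff i B)) : ∃ i : ℕ, IsUnit (coeff i (A * B)) := by
  have hprime : Prime (C ((p : ℕ) : unrIntegers p) : UnrSeries p) :=
    prime_C_of_prime CongruenceDescent.prime_natCast_p_unrIntegers
  refine exists_isUnit_coeff_of_not_C_dvd fun h ↦ ?_
  rcases hprime.dvd_or_dvd h with h | h
  · exact not_C_dvd_of_exists_isUnit_coeff hA h
  · exact not_C_dvd_of_exists_isUnit_coeff hB h

/-- **The finite-`μ` split**: a non-zero `Z ∈ R₀⟦T⟧` is `C p^t·Z′` with `Z′` having a unit coefficient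
(`WfDvdMonoid.max_power_factor` in the Noetherian domain `R₀⟦T⟧`). [cite: Washington1997, §7.1] -/
theorem exists_eq_C_pow_mul_of_ne_zero {Z : UnrSeries p} (hZ : Z ≠ 0) :
    ∃ (t : ℕ) (Z' : UnrSeries p), (∃ i : ℕ, IsUnit (coeff i Z')) ∧
      Z = C ((p : ℕ) : unrIntegers p) ^ t * Z' := by
  haveI := HidaLimitAlgebra.isNoetherianRing_unrSeries (p := p)
  haveI : WfDvdMonoid (UnrSeries p) := IsNoetherianRing.wfDvdMonoid
  have hprime : Prime (C ((p : ℕ) : unrIntegers p) : UnrSeries p) :=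
    prime_C_of_prime CongruenceDescent.prime_natCast_p_unrIntegers
  obtain ⟨t, Z', hZ', hfac⟩ := WfDvdMonoid.max_power_factor hZ hprime.irreducible
  exact ⟨t, Z', exists_isUnit_coeff_of_not_C_dvd hZ', hfac⟩

end UnrShape

/-! ### §3 The universal receptacle `R₀ ⊗_{ℤ_p} 𝒪`: `p`-torsion-free, and received by every receptacle -/

section Receptacle

variable (p : ℕ) [Fact p.Prime] [Algebra ℤ_[p] (unrIntegers p)]
  (𝒪 : Type) [CommRing 𝒪] [Algebra ℤ_[p] 𝒪]

/-- `R₀ ⊗_{ℤ_p} 𝒪` is `p`-torsion-free when `𝒪` is a free `ℤ_p`-module (it is then a free `R₀`-module, and `R₀`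
is a domain with `p ≠ 0`). [folklore] -/
theorem eq_zero_of_natCast_p_mul_eq_zero_receptacle [Module.Free ℤ_[p] 𝒪] (x : unrIntegers p ⊗[ℤ_[p]] 𝒪)
    (hx : ((p : ℕ) : unrIntegers p ⊗[ℤ_[p]] 𝒪) * x = 0) : x = 0 := by
  have h : ((p : ℕ) : unrIntegers p) • x = 0 := by
    rwa [Algebra.smul_def, map_natCast]
  exact (smul_eq_zero.mp h).resolve_left CongruenceDescent.prime_natCast_p_unrIntegers.ne_zero

/-- **Every receptacle receives the universal one**: for ring maps `a : R₀ → S₀`, `b : 𝒪 → S₀` agreeing on `ℤ_p`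
(`a ∘ toUnr = b ∘ (ℤ_p → 𝒪)`, the structure map of `R₀` being `toUnr`) there is `ψ : R₀ ⊗_{ℤ_p} 𝒪 → S₀` with
`ψ ∘ (R₀ → R₀ ⊗ 𝒪) = a` and `ψ ∘ includeRight = b` (`Algebra.TensorProduct.lift`). [folklore] -/
theorem exists_ringHom_receptacle (hj : algebraMap ℤ_[p] (unrIntegers p) = toUnr p)
    (S₀ : Type) [CommRing S₀] (a : unrIntegers p →+* S₀) (b : 𝒪 →+* S₀)
    (hab : a.comp (toUnr p) = b.comp (algebraMap ℤ_[p] 𝒪)) :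
    ∃ ψ : unrIntegers p ⊗[ℤ_[p]] 𝒪 →+* S₀,
      ψ.comp (algebraMap (unrIntegers p) (unrIntegers p ⊗[ℤ_[p]] 𝒪)) = a ∧
      ψ.comp (Algebra.TensorProduct.includeRight (R := ℤ_[p]) (A := unrIntegers p) (B := 𝒪)).toRingHom = b := by
  letI : Algebra ℤ_[p] S₀ := (b.comp (algebraMap ℤ_[p] 𝒪)).toAlgebra
  let fa : unrIntegers p →ₐ[ℤ_[p]] S₀ :=
    { toRingHom := a
      commutes' := fun r ↦ by
        change a (algebraMap ℤ_[p] (unrIntegers p) r) = (b.comp (algebraMap ℤ_[p] 𝒪)) r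
        rw [hj, ← hab, RingHom.comp_apply] }
  let gb : 𝒪 →ₐ[ℤ_[p]] S₀ :=
    { toRingHom := b
      commutes' := fun _ ↦ rfl }
  refine ⟨(Algebra.TensorProduct.lift fa gb fun x y ↦ Commute.all _ _).toRingHom, ?_, ?_⟩
  · ext x
    rw [RingHom.comp_apply, Algebra.TensorProduct.algebraMap_apply, Algebra.algebraMap_self, RingHom.id_apply,
      AlgHom.toRingHom_eq_coe, AlgHom.coe_toRingHom, Algebra.TensorProduct.lift_tmul, map_one, mul_one]
    rfl
  · ext y
    rw [RingHom.comp_apply, AlgHom.toRingHom_eq_coe, AlgHom.coe_toRingHom, AlgHom.toRingHom_eq_coe,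
      AlgHom.coe_toRingHom, Algebra.TensorProduct.includeRight_apply, Algebra.TensorProduct.lift_tmul, map_one,
      one_mul]
    rfl

/-- **The per-level receptacle clause from a unit congruence, abstractly.** Data: an ideal `Ch ⊆ 𝒪⟦T⟧` (the member's
characteristic ideal), a proposition `Tors` (its torsion premise), `M = C p^t·M′ ∈ R₀⟦T⟧` with
`M′ = X^s·V + C p·Q`, `V` a unit (the shape of `L·P_Σ` when `μ(L) = 0`, `P_Σ = p^t·P′`), and a level `m > t`. IF in
every `p`-torsion-free receptacle `(S₀, a, b)` some `L_m` has a UNIT congruence `L_m ≡ u·a(M) (mod p^m)` and, under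
`Tors`, `(p^e)·Ch·S₀⟦T⟧ ⊆ (L_m)` for SOME `e`, THEN in EVERY receptacle some `L_m` has, under `Tors`,
`(p^t)·Ch·S₀⟦T⟧ ⊆ (L_m)` (exponent `t`, uniform) and `(L_m) ⊆ (a(M)) + (p^m)`: instantiate at the universal receptacle
`R₀ ⊗_{ℤ_p} 𝒪` (`p`-torsion-free for `𝒪` free), saturate (`span_pow_mul_le_of_unitCong`), push forward along
`exists_ringHom_receptacle`. [folklore] -/
theorem receptacle_clause_of_unitCong [Module.Free ℤ_[p] 𝒪] (hj : algebraMap ℤ_[p] (unrIntegers p) = toUnr p)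
    (Ch : Ideal (PowerSeries 𝒪)) (Tors : Prop) (M M' V Q : UnrSeries p) (t s m : ℕ) (hV : IsUnit V)
    (hM : M = C ((p : ℕ) : unrIntegers p) ^ t * M') (hM' : M' = X ^ s * V + C ((p : ℕ) : unrIntegers p) * Q)
    (htm : t < m)
    (hD : ∀ (S₀ : Type) [CommRing S₀] (a : unrIntegers p →+* S₀) (b : 𝒪 →+* S₀),
      a.comp (toUnr p) = b.comp (algebraMap ℤ_[p] 𝒪) → (∀ x : S₀, ((p : ℕ) : S₀) * x = 0 → x = 0) →
      ∃ Lm u : PowerSeries S₀, IsUnit u ∧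
        Lm - u * PowerSeries.map a M ∈ Ideal.span {((p : ℕ) : PowerSeries S₀) ^ m} ∧
        (Tors → ∃ e : ℕ, Ideal.span {((p : ℕ) : PowerSeries S₀) ^ e} * Ch.map (PowerSeries.map b) ≤
          Ideal.span {Lm}))
    (S₀ : Type) [CommRing S₀] (a : unrIntegers p →+* S₀) (b : 𝒪 →+* S₀)
    (hab : a.comp (toUnr p) = b.comp (algebraMap ℤ_[p] 𝒪)) :
    ∃ Lm : PowerSeries S₀,
      (Tors → Ideal.span {((p : ℕ) : PowerSeries S₀) ^ t} * Ch.map (PowerSeries.map b) ≤ Ideal.span {Lm}) ∧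
      Ideal.span {Lm} ≤ Ideal.span {PowerSeries.map a M} ⊔ Ideal.span {((p : ℕ) : PowerSeries S₀) ^ m} := by
  have hreg : ∀ x : unrIntegers p ⊗[ℤ_[p]] 𝒪, ((p : ℕ) : unrIntegers p ⊗[ℤ_[p]] 𝒪) * x = 0 → x = 0 :=
    eq_zero_of_natCast_p_mul_eq_zero_receptacle p 𝒪
  obtain ⟨Lm, u, hu, hcong, hK1⟩ := hD (unrIntegers p ⊗[ℤ_[p]] 𝒪) (algebraMap _ _)
    (Algebra.TensorProduct.includeRight (R := ℤ_[p]) (A := unrIntegers p) (B := 𝒪)).toRingHom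
    (RoadFFMember.algebraMap_comp_toUnr_eq p 𝒪 hj) hreg
  obtain ⟨ψ, hψa, hψb⟩ := exists_ringHom_receptacle p 𝒪 hj S₀ a b hab
  -- unpack (K2′): `L_m = u·(C p^t·a′(M′)) + C p^m·G₀`
  obtain ⟨G₀, hG₀⟩ := Ideal.mem_span_singleton'.mp hcong
  have h3 : ((p : ℕ) : PowerSeries (unrIntegers p ⊗[ℤ_[p]] 𝒪)) = C ((p : ℕ) : unrIntegers p ⊗[ℤ_[p]] 𝒪) :=
    (map_natCast C p).symm
  have hMa : PowerSeries.map (algebraMap (unrIntegers p) (unrIntegers p ⊗[ℤ_[p]] 𝒪)) M =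
      C ((p : ℕ) : unrIntegers p ⊗[ℤ_[p]] 𝒪) ^ t *
        PowerSeries.map (algebraMap (unrIntegers p) (unrIntegers p ⊗[ℤ_[p]] 𝒪)) M' := by
    rw [hM, map_mul, map_pow, map_C, map_natCast]
  have hshape' : PowerSeries.map (algebraMap (unrIntegers p) (unrIntegers p ⊗[ℤ_[p]] 𝒪)) M' =
      X ^ s * PowerSeries.map (algebraMap (unrIntegers p) (unrIntegers p ⊗[ℤ_[p]] 𝒪)) V +
        C ((p : ℕ) : unrIntegers p ⊗[ℤ_[p]] 𝒪) *
          PowerSeries.map (algebraMap (unrIntegers p) (unrIntegers p ⊗[ℤ_[p]] 𝒪)) Q := by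
    rw [hM', map_add, map_mul, map_mul, map_pow, map_X, map_C, map_natCast]
  have hLm : Lm = u * (C ((p : ℕ) : unrIntegers p ⊗[ℤ_[p]] 𝒪) ^ t *
      PowerSeries.map (algebraMap (unrIntegers p) (unrIntegers p ⊗[ℤ_[p]] 𝒪)) M') +
        C ((p : ℕ) : unrIntegers p ⊗[ℤ_[p]] 𝒪) ^ m * G₀ := by
    rw [← hMa, ← h3]
    linear_combination (-1 : PowerSeries (unrIntegers p ⊗[ℤ_[p]] 𝒪)) * hG₀
  refine ⟨PowerSeries.map ψ Lm, fun hT ↦ ?_, ?_⟩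
  · -- (K1) with exponent `t` at the universal receptacle, pushed forward along `ψ`
    obtain ⟨e, he⟩ := hK1 hT
    rw [h3] at he
    have hsat := span_pow_mul_le_of_unitCong hreg hu (hV.map _) s t m e htm hshape' hLm _ he
    have hpush := Ideal.map_mono (f := PowerSeries.map ψ) hsat
    rw [Ideal.map_mul, Ideal.map_span, Set.image_singleton, Ideal.map_span, Set.image_singleton, Ideal.map_map,
      ← PowerSeries.map_comp, hψb, map_pow, PowerSeries.map_C, map_natCast, map_natCast] at hpush
    exact hpush
  · -- (K2) one-sided at `S₀`
    have hcomp : PowerSeries.map ψ (PowerSeries.map (algebraMap (unrIntegers p) (unrIntegers p ⊗[ℤ_[p]] 𝒪)) M) =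
        PowerSeries.map a M := by
      rw [← hψa, PowerSeries.map_comp, RingHom.comp_apply]
    rw [Ideal.span_singleton_le_iff_mem, hLm, ← hMa, map_add, map_mul, map_mul, hcomp, map_pow, PowerSeries.map_C,
      map_natCast, map_natCast]
    exact Ideal.add_mem _ (Ideal.mem_sup_left (Ideal.mul_mem_left _ _ (Ideal.mem_span_singleton_self _)))
      (Ideal.mem_sup_right (Ideal.mul_mem_right _ _ (Ideal.mem_span_singleton_self _)))

end Receptacle

end Summit.BirchSwinnertonDyer.Rank1Residual.X11b.RoadFFSaturation

end
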